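import Literature.AlgebraicGeometry.Frobenioids.UnitTrivialModelType
import Literature.AlgebraicGeometry.Frobenioids.UnitTrivializationIsFrobenioid
import HarnessLib

/-!
# Frobenioids I, Proposition 5.5 (iii), first sentence, the unit-trivialization half:
# `C^un-tr` is of model type (abc-iut cell, layer L1, node `FrdI:Prop5.5(iii)`, sub-DAG row
# `FrdI:Prop5.5(iii)/P55-L05` «UntrRlfModelType», un-tr half)

Mochizuki, *The geometry of Frobenioids I: the general theory*, Kyushu J. Math. **62** (2008)
293–400, §5, Proposition 5.5 (iii), kurims text p. 104 (statement) and proof p. 105 ll. 9–11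
[cite: MochizukiFrdI2008, Prop. 5.5 (iii) p.104]:

> "First, observe that by Proposition 5.3; Theorems 5.1, (iv); 5.2, (ii), it follows that
> `C^un-tr`, `C^rlf` are Frobenioids of model, hence also of isotropic and birationally
> Frobenius-normalized, type."

PROOF-ONLY companion (no definitions): the `C^un-tr` half, by Theorem 5.1 (iv) exactly as printed.
For a Frobenioid `F : C → F_Φ`, THE unit-trivialization `C^un-tr = (PreFrobenioidData.ofFunctor Φ F).Untr`
with its structure functor `untrFunctor hF : C^un-tr → F_Φ` (seat abc-iut-L1-d5, `UnitTrivializationFunctor.lean`)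
is a Frobenioid (`isFrobenioid_untr`, `UnitTrivializationIsFrobenioid.lean`) of isotropic
(`isOfIsotropicType_untr`) and unit-trivial (`isOfUnitTrivialType_untr`) type, with the square-completion
property (`hasBiratSquares_untr`); hence Theorem 5.1 (iv) "Moreover, `C` is of model type"
(`isOfModelType_of_isOfUnitTrivialType`, `UnitTrivialModelType.lean`, this seat) applies verbatim:
`C^un-tr` is of model type (`IsOfModelType`, Def. 4.5 (i), seat abc-iut-L6-t8's vocabulary of
`ModelFrobenioidComparison.lean` — the hypothesis shape of Thm. 5.2 (iv)), in particular every object of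
`C^un-tr` is birationally Frobenius-normalized, for THE birationalization of `C^un-tr`; and its
structure functor `(C^un-tr)^birat → F_{Φ^gp}` is faithful. The `C^rlf` half of the sentence is the
realification row (seats abc-iut-L1-d2 / abc-iut-L1-t5, `RealificationModelRow.lean`; model Frobenioids
are birationally Frobenius-normalized by seat abc-iut-L1-d10's `ModelFrobenioidBiratNormalized.lean`)
and is not treated here. No statement of the paper is strengthened; no side is taken on [IUTchIII]
Cor. 3.12.
-/

namespace Literature.AlgebraicGeometry.Frobenioids

namespace PreFrobenioid

open CategoryTheory

universe w v v' u u'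

variable {D : Type u} [Category.{v} D] {Φ : Dᵒᵖ ⥤ CommMonCat.{w}}
  {C : Type u'} [Category.{v'} C] {F : C ⥤ ElemFrobenioid Φ}

/-- The unit-trivialization `C^un-tr → F_Φ` of a Frobenioid is of Frobenius-normalized type (its structure
functor is faithful: seat abc-iut-L1-d5's `untrFunctor_faithful`, [FrdI] Prop. 3.3 (iv)).
[cite: MochizukiFrdI2008, Prop. 3.3 (iv) p.60] -/
theorem isOfFrobeniusNormalizedType_untr (hF : IsFrobenioid F) :
    IsOfType (IsFrobeniusNormalized (untrFunctor hF)) :=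
  haveI := untrFunctor_faithful hF
  fun X => isFrobeniusNormalized_of_faithful (untrFunctor hF) X

/-- **Prop. 5.5 (iii)**, proof, `C^un-tr` half: the structure functor `(C^un-tr)^birat → F_{Φ^gp}` of THE
birationalization of the unit-trivialization of a Frobenioid is faithful (Thm. 5.1 (iv) applied to the
Frobenioid `C^un-tr` of isotropic and unit-trivial type). [cite: MochizukiFrdI2008, Prop. 5.5 (iii) p.105] -/
theorem Birat.toElemGp_faithful_untr (hF : IsFrobenioid F) (hsq : HasBiratSquares (untrFunctor hF)) :
    (Birat.toElemGp (isFrobenioid_untr hF) hsq).Faithful :=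
  Birat.toElemGp_faithful (isFrobenioid_untr hF) hsq (isOfIsotropicType_untr hF)
    (isOfUnitTrivialType_untr hF)

/-- **Prop. 5.5 (iii)**, first sentence, `C^un-tr` half: every object of `C^un-tr` is birationally
Frobenius-normalized (Def. 4.5 (i), for THE birationalization of `C^un-tr`) — "by Theorem 5.1 (iv)".
[cite: MochizukiFrdI2008, Prop. 5.5 (iii) p.105] -/
theorem isBiratFrobeniusNormalized_untr (hF : IsFrobenioid F) (hsq : HasBiratSquares (untrFunctor hF))
    (X : (PreFrobenioidData.ofFunctor Φ F).Untr) :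
    IsBiratFrobeniusNormalized (untrFunctor hF) (isFrobenioid_untr hF) hsq X :=
  isBiratFrobeniusNormalized_of_isOfUnitTrivialType (untrFunctor hF) (isFrobenioid_untr hF) hsq
    (isOfIsotropicType_untr hF) (isOfUnitTrivialType_untr hF) X

/-- **Prop. 5.5 (iii)**, first sentence, `C^un-tr` half, over seat abc-iut-L1-t3's interface: THE
birationalization of `C^un-tr` is of birationally Frobenius-normalized type
(`PreFrobenioidData.IsOfBiratFrobeniusNormalizedType`). [cite: MochizukiFrdI2008, Prop. 5.5 (iii) p.105] -/
theorem isOfBiratFrobeniusNormalizedType_biratData_untr (hF : IsFrobenioid F)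
    (hsq : HasBiratSquares (untrFunctor hF)) :
    PreFrobenioidData.IsOfBiratFrobeniusNormalizedType (biratData (isFrobenioid_untr hF) hsq) :=
  isOfBiratFrobeniusNormalizedType_biratData_of_isOfUnitTrivialType (isFrobenioid_untr hF) hsq
    (isOfIsotropicType_untr hF) (isOfUnitTrivialType_untr hF)

/-- **Prop. 5.5 (iii)**, first sentence, `C^un-tr` half: "`C^un-tr` … [is a Frobenioid] of model …
type" — `IsOfModelType` (Def. 4.5 (i): pre-model AND birationally Frobenius-normalized) for the
Frobenioid `C^un-tr → F_Φ` and any square-completion datum of it, by Theorem 5.1 (iv)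
(`isOfModelType_of_isOfUnitTrivialType`). [cite: MochizukiFrdI2008, Prop. 5.5 (iii) p.105] -/
theorem isOfModelType_untr (hF : IsFrobenioid F) (hsq : HasBiratSquares (untrFunctor hF)) :
    IsOfModelType (untrFunctor hF) (isFrobenioid_untr hF) hsq :=
  isOfModelType_of_isOfUnitTrivialType (untrFunctor hF) (isFrobenioid_untr hF) hsq
    (isOfIsotropicType_untr hF) (isOfUnitTrivialType_untr hF)

/-- **Prop. 5.5 (iii)**, first sentence, `C^un-tr` half, with the square-completion property of `C^un-tr`
discharged (`hasBiratSquares_untr`): `C^un-tr` is of model type for THE birationalization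
`Birat (untrFunctor hF) (isFrobenioid_untr hF) (hasBiratSquares_untr hF)`.
[cite: MochizukiFrdI2008, Prop. 5.5 (iii) p.105] -/
theorem isOfModelType_untr' (hF : IsFrobenioid F) :
    IsOfModelType (untrFunctor hF) (isFrobenioid_untr hF) (hasBiratSquares_untr hF) :=
  isOfModelType_untr hF (hasBiratSquares_untr hF)

/-- **Prop. 5.5 (iii)**, first sentence: "`C^un-tr` … hence also of isotropic … type" (recorded: this
clause is seat abc-iut-L1-d5's `isOfIsotropicType_untr`, restated here next to the model-type clause
for the consumer's convenience). [cite: MochizukiFrdI2008, Prop. 5.5 (iii) p.105] -/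
theorem isOfIsotropicType_and_isOfModelType_untr (hF : IsFrobenioid F) :
    IsOfIsotropicType (untrFunctor hF) ∧
      IsOfModelType (untrFunctor hF) (isFrobenioid_untr hF) (hasBiratSquares_untr hF) :=
  ⟨isOfIsotropicType_untr hF, isOfModelType_untr' hF⟩

end PreFrobenioid

end Literature.AlgebraicGeometry.Frobenioids
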